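import Mathlib
import Summits.NavierStokesRegularity.NavierStokesRegularity.Theorems.ScenarioCensusPeriodicSlabDecayTerms
import Summits.NavierStokesRegularity.NavierStokesRegularity.Theorems.ScenarioCensusHelicalSlabLiouville
import HarnessLib

/-!
# Census row S7 (c): bounded periodic steady flows with `r u^r → 0` are axial constants
# (Bang–Gui–Wang–Xie 2025, Thm 1.4 (c))

Support file for the scenario census of `NavierStokesRegularity` (cell `pub/ns-census`, block S,
row S7 = Bang–Gui–Wang–Xie, J. Fluid Mech. 1005 (2025) A6 = arXiv:2205.13259, Thm 1.4; tree FACT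
`Literature.Analysis.FluidPDE.BangGuiWangXie2025_periodicSlab_liouville`). Case (c): "Let `u` be
a bounded smooth solution to the Navier–Stokes system in `ℝ² × 𝕋`. Then `u` must be a constant
vector provided that … (c) `r u^r` converges to `0`, as `r → +∞` … the constant vector `u` must
be of the form `(0, 0, c)`." Printed proof, §5 Step 3: the Saint-Venant estimate
`Y(R) ≤ C₁ R‖u^r‖_{L^∞(𝒪_R)} + C₂ R^{1/2} Y'(R)^{1/2}`, then "since `r u^r` converges to zero,
there exists some `R₁ > R₀` such that `Y(R₀) ≥ 2C₁ R‖u^r‖_{L^∞(𝒪_R)}` for every `R ≥ R₁`. Hence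
`Y(R) ≤ 2C₂ R^{1/2} Y'(R)^{1/2}`, which leads to contradiction."

* `saintVenant_dyadic_eventually` — the dyadic Saint-Venant lemma with an additive `o(1)` term
  (reduction to `saintVenant_dyadic` by the printed absorption argument and a rescaling);
* `decay_energy_dyadic_estimate` — the energy form of `decay_dyadic_weighted_estimate`;
* `periodicSlab_liouville_radialDecay` — **Thm 1.4 (c)** for every `ν > 0`, `L > 0`: a smooth
  steady solution (`IsLerayProfile ν 0 U P`, `U, P ∈ C^∞`), bounded, axially `L`-periodic, with
  `r u^r → 0` uniformly, is `U ≡ c e₃`.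

No summit statement and no census row is proved in this file (the by-name closer of row S7 is
the leaf file `ScenarioCensusSteadyS7.lean`).

## References

* J. Bang, C. Gui, Y. Wang, C. Xie, arXiv:2205.13259, Thm 1.4 (c), §5 Step 3.
  [BangGuiWangXie2025]
-/

-- the summit and its single problem share the name (D-0017 nested layout)
set_option linter.dupNamespace false

noncomputable section

open MeasureTheory Set Function Filter InnerProductSpace
open scoped Topology ENNReal NNReal RealInnerProductSpace Laplacian ContDiff

namespace Summit.NavierStokesRegularity.NavierStokesRegularity.Theorems.ScenarioCensus.PeriodicSlab

open Literature.Analysis Literature.Analysis.FluidPDE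
open Summit.NavierStokesRegularity.NavierStokesRegularity.Theorems.ScenarioCensus.HelicalSlab

/-! ### The dyadic Saint-Venant lemma with an `o(1)` term -/

/-- **The dyadic Saint-Venant lemma with a vanishing additive term.** Let `E` be nondecreasing
and nonnegative on `[1, ∞)` with `E(r) ≤ A r²`, and suppose that for every `ε > 0` there is
`R ≥ 1` with `E(r) ≤ ε + γ (E(2r) − E(r))/r + a λ r + b (E(2r) − E(r))/(λ r)` for all `r ≥ R`,
`λ > 0` (`γ, a, b ≥ 0`). Then `E ≡ 0` on `[1, ∞)`. (If `E(r₀) > 0`, take `ε = E(r₀)/2`, absorb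
it for `r ≥ max R r₀`, rescale `r = R₁ s` and apply `saintVenant_dyadic` with `ν = 1/2`.) -/
theorem saintVenant_dyadic_eventually {E : ℝ → ℝ} {γ a b A : ℝ} (hγ : 0 ≤ γ) (ha : 0 ≤ a)
    (hb : 0 ≤ b) (hmono : ∀ r s, 1 ≤ r → r ≤ s → E r ≤ E s) (h0 : ∀ r, 1 ≤ r → 0 ≤ E r)
    (hA : ∀ r, 1 ≤ r → E r ≤ A * r ^ 2)
    (h : ∀ ε : ℝ, 0 < ε → ∃ R : ℝ, 1 ≤ R ∧ ∀ r, R ≤ r → ∀ lam : ℝ, 0 < lam →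
      E r ≤ ε + γ * (E (2 * r) - E r) / r + a * lam * r + b * (E (2 * r) - E r) / (lam * r)) :
    ∀ r, 1 ≤ r → E r = 0 := by
  intro r₀ hr₀
  by_contra hne
  have he₀ : 0 < E r₀ := lt_of_le_of_ne (h0 r₀ hr₀) (Ne.symm hne)
  obtain ⟨R, hR1, hR⟩ := h (E r₀ / 2) (by linarith)
  set R₁ : ℝ := max R r₀ with hR₁
  have hR₁R : R ≤ R₁ := le_max_left _ _
  have hR₁r₀ : r₀ ≤ R₁ := le_max_right _ _
  have hR₁1 : 1 ≤ R₁ := le_trans hr₀ hR₁r₀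
  have hR₁0 : 0 < R₁ := by linarith
  -- the rescaled energy
  set E' : ℝ → ℝ := fun s => E (R₁ * s) with hE'
  have hmono' : ∀ s t, 1 ≤ s → s ≤ t → E' s ≤ E' t := fun s t hs hst =>
    hmono _ _ (by nlinarith) (mul_le_mul_of_nonneg_left hst hR₁0.le)
  have h0' : ∀ s, 1 ≤ s → 0 ≤ E' s := fun s hs => h0 _ (by nlinarith)
  have hA' : ∀ s, 1 ≤ s → E' s ≤ A * R₁ ^ 2 * s ^ 2 := fun s hs => by
    have := hA (R₁ * s) (by nlinarith)
    simp only [hE']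
    nlinarith
  have hineq : ∀ s, 1 ≤ s → ∀ lam : ℝ, 0 < lam →
      (1 / 2) * E' s ≤ γ / R₁ * (E' (2 * s) - E' s) / s + (a * R₁) * lam * s +
        b / R₁ * (E' (2 * s) - E' s) / (lam * s) := by
    intro s hs lam hlam
    have hs0 : 0 < s := by linarith
    have hrR : R ≤ R₁ * s := le_trans hR₁R (by nlinarith)
    have h1 := hR (R₁ * s) hrR lam hlam
    have h2 : E r₀ ≤ E (R₁ * s) := hmono _ _ hr₀ (le_trans hR₁r₀ (by nlinarith))
    have e1 : E (2 * (R₁ * s)) = E' (2 * s) := by simp only [hE']; ring_nf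
    have e2 : E (R₁ * s) = E' s := rfl
    rw [e1, e2] at h1
    rw [e2] at h2
    have e3 : γ * (E' (2 * s) - E' s) / (R₁ * s) = γ / R₁ * (E' (2 * s) - E' s) / s := by
      field_simp
    have e4 : b * (E' (2 * s) - E' s) / (lam * (R₁ * s)) = b / R₁ * (E' (2 * s) - E' s) / (lam * s) := by
      field_simp
    have e5 : a * lam * (R₁ * s) = (a * R₁) * lam * s := by ring
    rw [e3, e4, e5] at h1
    linarith
  have hzero := saintVenant_dyadic (ν := 1 / 2) (by norm_num) (div_nonneg hγ hR₁0.le)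
    (mul_nonneg ha hR₁0.le) (div_nonneg hb hR₁0.le) hmono' h0' hA' hineq 1 le_rfl
  have h3 : E r₀ ≤ E' 1 := by simp only [hE', mul_one]; exact hmono _ _ hr₀ hR₁r₀
  linarith

/-! ### The dyadic estimate in energy form -/

/-- **The dyadic energy estimate under radial decay.** For a smooth steady flow at unit
viscosity, axially periodic with periodic pressure, bounded with bounded gradient and pressure
gradient (`‖U‖ ≤ M`, `‖DU‖ ≤ K₁`, `|DU|² ≤ B`, `‖DP‖ ≤ K₃`), whose radial velocity satisfies
`sup_{ρ ≥ R} |⟪x_h, U⟫| → 0` as `R → ∞`: with `E(r) = ∫_{zSlab L 0 ∩ {ρ<r}} |DU|²` there are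
`a, c, K ≥ 0` such that for every `0 < ε ≤ 1` there is `R ≥ 1` with
`E(r) ≤ K ε + a λ r + c (E(2r) − E(r))/(λ r)` for all `r ≥ R`, `λ > 0`. -/
theorem decay_energy_dyadic_estimate {L M K₁ K₃ B : ℝ} (hL : 0 < L)
    {U : EuclideanSpace ℝ (Fin 3) → EuclideanSpace ℝ (Fin 3)} {P : EuclideanSpace ℝ (Fin 3) → ℝ}
    (h : IsLerayProfile 1 0 U P) (hU : ContDiff ℝ (⊤ : ℕ∞) U) (hP : ContDiff ℝ (⊤ : ℕ∞) P)
    (hUper : IsAxiallyPeriodic L U) (hPper : IsAxiallyPeriodic L P)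
    (hM : ∀ x, ‖U x‖ ≤ M) (hK₁ : ∀ x, ‖fderiv ℝ U x‖ ≤ K₁)
    (hB : ∀ x, frobeniusNormSq (fderiv ℝ U x) ≤ B) (hK₃ : ∀ x, ‖fderiv ℝ P x‖ ≤ K₃)
    (hdecay : ∀ ε : ℝ, 0 < ε → ∃ R : ℝ, ∀ x, R ≤ cylRadius x → |⟪horizPart x, U x⟫| ≤ ε)
    (E : ℝ → ℝ) (hE : ∀ r, E r = ∫ x in zSlab L 0 ∩ {x | cylRadius x < r},
      frobeniusNormSq (fderiv ℝ U x)) :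
    ∃ a c K : ℝ, 0 ≤ a ∧ 0 ≤ c ∧ 0 ≤ K ∧ ∀ ε : ℝ, 0 < ε → ε ≤ 1 → ∃ R : ℝ, 1 ≤ R ∧
      ∀ r : ℝ, R ≤ r → ∀ lam : ℝ, 0 < lam →
        E r ≤ K * ε + a * lam * r + c * (E (2 * r) - E r) / (lam * r) := by
  obtain ⟨C, hC0, hC⟩ := exists_corrField_bounds
  have hM0 : 0 ≤ M := (norm_nonneg _).trans (hM 0)
  have hK₃0 : 0 ≤ K₃ := (norm_nonneg _).trans (hK₃ 0)
  have hU1 : ContDiff ℝ 1 U := contDiff_infty.1 hU 1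
  set F : EuclideanSpace ℝ (Fin 3) → ℝ := fun x => frobeniusNormSq (fderiv ℝ U x) with hF
  have hFc : Continuous F := continuous_frobeniusNormSq_fderiv hU1 one_ne_zero
  have hF0 : ∀ x, 0 ≤ F x := fun x => frobeniusNormSq_nonneg _
  refine ⟨96 * C * M * L + 48 * C * L * (3 * M + Real.pi) + 16 * C * L * M * (Real.pi + M),
    3 * C * M + 3 / 2 * C * (3 * M + Real.pi) + 1 / 2 * C * M * (Real.pi + M),
    16 * C * M ^ 2 * L + 64 * C * K₃ * L ^ 2, by positivity, by positivity, by positivity, ?_⟩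
  intro ε hε hε1
  obtain ⟨R₀, hR₀⟩ := hdecay ε hε
  refine ⟨max 1 R₀, le_max_left _ _, fun r hr lam hlam => ?_⟩
  have hr1 : 1 ≤ r := le_trans (le_max_left _ _) hr
  have hr0 : 0 < r := by linarith
  have hr2 : r < 2 * r := by linarith
  have hdec : ∀ x, r ≤ cylRadius x → |⟪horizPart x, U x⟫| ≤ ε := fun x hx =>
    hR₀ x (le_trans (le_trans (le_max_right _ _) hr) hx)
  obtain ⟨ha, hW, hDW⟩ := hC r hr0
  have hA := decay_dyadic_weighted_estimate hL h hU hP hUper hPper hM hK₁ hK₃ hB hC0 ha hW hDW hr1 hlam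
    hε hε1 hdec
  -- abbreviations
  set S : Set (EuclideanSpace ℝ (Fin 3)) := zSlab L 0 with hS
  set φ : EuclideanSpace ℝ (Fin 3) → ℝ := cylCutoff r (2 * r) with hφ
  set A : Set (EuclideanSpace ℝ (Fin 3)) := {x | r ≤ cylRadius x ∧ cylRadius x < 2 * r} with hAdef
  set χ : EuclideanSpace ℝ (Fin 3) → ℝ := A.indicator fun _ => (1 : ℝ) with hχ
  set Iφ : ℝ := ∫ x in S, φ x * F x with hIφ
  set D : ℝ := ∫ x in S, χ x * F x with hD
  have hφc : Continuous φ := (contDiff_cylCutoff r (2 * r) (n := 0)).continuous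
  have hφnn : ∀ x, 0 ≤ φ x := cylCutoff_nonneg r (2 * r)
  have hφone : ∀ x, cylRadius x ≤ r → φ x = 1 := fun x hx => cylCutoff_eq_one hr0.le hr2 hx
  have hφzero : ∀ x, 2 * r ≤ cylRadius x → φ x = 0 := fun x hx => cylCutoff_eq_zero hr0.le hr2 hx
  have hAm : MeasurableSet A :=
    (isClosed_le continuous_const continuous_cylRadius).measurableSet.inter
      (isOpen_lt continuous_cylRadius continuous_const).measurableSet
  have hIφ_int : IntegrableOn (fun x => φ x * F x) S volume :=
    integrableOn_zSlab_of_eq_zero_of_le_cylRadius (Q := fun x => φ x * F x) (hφc.mul hFc)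
      (fun x hx => by show φ x * F x = 0; rw [hφzero x hx, zero_mul]) L 0
  have hF_int2 : IntegrableOn F (S ∩ {x | cylRadius x < 2 * r}) volume :=
    integrableOn_zSlab_inter_cyl_of_bound hL (by linarith) hFc (B := B) fun x => by
      rw [Real.norm_of_nonneg (hF0 x)]; exact hB x
  have hmeas : MeasurableSet (S ∩ {x : EuclideanSpace ℝ (Fin 3) | cylRadius x < r}) :=
    (measurableSet_zSlab L 0).inter (isOpen_lt continuous_cylRadius continuous_const).measurableSet
  have hsub : S ∩ {x | cylRadius x < r} ⊆ S ∩ {x | cylRadius x < 2 * r} :=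
    fun x hx => ⟨hx.1, lt_trans hx.2 hr2⟩
  -- `E(r) ≤ Iφ`
  have hEr : E r ≤ Iφ := by
    rw [hE r]
    calc ∫ x in S ∩ {x | cylRadius x < r}, F x
        = ∫ x in S, (S ∩ {x | cylRadius x < r}).indicator F x := by
          rw [setIntegral_indicator hmeas, Set.inter_eq_self_of_subset_right inter_subset_left]
      _ ≤ Iφ := by
          refine setIntegral_mono_on ((hF_int2.mono_set hsub).integrable_indicator hmeas |>.integrableOn)
            hIφ_int (measurableSet_zSlab L 0) fun x _ => ?_
          by_cases hx : x ∈ S ∩ {x | cylRadius x < r}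
          · rw [Set.indicator_of_mem hx, hφone x (le_of_lt hx.2), one_mul]
          · rw [Set.indicator_of_notMem hx]; exact mul_nonneg (hφnn x) (hF0 x)
  -- `E(2r) − E(r) = D`
  have hED : E (2 * r) - E r = D := by
    rw [hE (2 * r), hE r, hD]
    have hdiff : (S ∩ {x | cylRadius x < 2 * r}) \ (S ∩ {x | cylRadius x < r}) = S ∩ A := by
      ext x
      constructor
      · rintro ⟨⟨hxS, hx2⟩, hnot⟩
        refine ⟨hxS, ?_, hx2⟩
        by_contra hlt
        exact hnot ⟨hxS, not_le.1 hlt⟩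
      · rintro ⟨hxS, h1, h2⟩
        exact ⟨⟨hxS, h2⟩, fun h' => (not_lt.2 h1) h'.2⟩
    rw [← setIntegral_sdiff hmeas hF_int2 hsub, hdiff, ← setIntegral_indicator hAm]
    refine setIntegral_congr_fun (measurableSet_zSlab L 0) fun x _ => ?_
    by_cases hx : x ∈ A
    · simp [hχ, hx]
    · simp [hχ, hx]
  rw [hED]
  exact hEr.trans hA

/-! ### The Liouville theorem -/

/-- **Bang–Gui–Wang–Xie 2025, Thm 1.4 (c), at unit viscosity.** A smooth steady Navier–Stokes
flow on `ℝ³` with `ν = 1` (`IsLerayProfile 1 0 U P`, `U, P ∈ C^∞`), bounded, axially `L`-periodic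
(`L > 0`), with `r u^r → 0` uniformly as `r → ∞`, is an axial constant `U ≡ c e₃`. -/
theorem periodicSlab_liouville_radialDecay_one {L : ℝ} (hL : 0 < L)
    {U : EuclideanSpace ℝ (Fin 3) → EuclideanSpace ℝ (Fin 3)} {P : EuclideanSpace ℝ (Fin 3) → ℝ}
    (hprof : IsLerayProfile 1 0 U P) (hU : ContDiff ℝ (⊤ : ℕ∞) U) (hP : ContDiff ℝ (⊤ : ℕ∞) P)
    (hbd : ∃ M : ℝ, ∀ x, ‖U x‖ ≤ M) (hper : IsAxiallyPeriodic L U)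
    (hdecay : ∀ ε : ℝ, 0 < ε → ∃ R : ℝ, ∀ x, R ≤ cylRadius x →
      |cylRadius x * radialVelocity U x| ≤ ε) :
    ∃ c : ℝ, U = fun _ => c • eZ := by
  obtain ⟨M, hM⟩ := hbd
  have hst : IsSteadyClassicalNS 1 0 U P := isSteadyClassicalNS_of_isLerayProfile hprof hU hP
  have hPper : IsAxiallyPeriodic L P := steady_pressure_periodic hL hst hM hper
  obtain ⟨K₁, K₂, K₃, -, -, -, hK⟩ := steady_derivative_bounds one_pos hst hM
  have hK₁ : ∀ x, ‖fderiv ℝ U x‖ ≤ K₁ := fun x => (hK x).1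
  have hK₃ : ∀ x, ‖fderiv ℝ P x‖ ≤ K₃ := fun x => by
    have e : ‖fderiv ℝ P x‖ = ‖gradient P x‖ := by
      rw [gradient]; exact ((InnerProductSpace.toDual ℝ (EuclideanSpace ℝ (Fin 3))).symm.norm_map _).symm
    rw [e]; exact (hK x).2.2
  have hU1 : ContDiff ℝ 1 U := contDiff_infty.1 hU 1
  have hUd : Differentiable ℝ U := hU1.differentiable one_ne_zero
  have hdecay' : ∀ ε : ℝ, 0 < ε → ∃ R : ℝ, ∀ x, R ≤ cylRadius x → |⟪horizPart x, U x⟫| ≤ ε := by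
    intro ε hε
    obtain ⟨R, hR⟩ := hdecay ε hε
    refine ⟨R, fun x hx => ?_⟩
    have e : ⟪horizPart x, U x⟫ = cylRadius x * radialVelocity U x := by
      rw [radialVelocity, horizPart_eq_cylRadius_smul_eR, real_inner_smul_left, real_inner_comm]
    rw [e]; exact hR x hx
  -- the period energies
  set F : EuclideanSpace ℝ (Fin 3) → ℝ := fun x => frobeniusNormSq (fderiv ℝ U x) with hF
  set E : ℝ → ℝ := fun r => ∫ x in zSlab L 0 ∩ {x | cylRadius x < r}, F x with hE
  have hFc : Continuous F := continuous_frobeniusNormSq_fderiv hU1 one_ne_zero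
  have hF0 : ∀ x, 0 ≤ F x := fun x => frobeniusNormSq_nonneg _
  set b := EuclideanSpace.basisFun (Fin 3) ℝ with hb
  have hFB' : ∀ x, F x ≤ 3 * K₁ ^ 2 := fun x => by
    show frobeniusNormSq (fderiv ℝ U x) ≤ 3 * K₁ ^ 2
    rw [frobeniusNormSq_eq_sum b]
    calc ∑ i, ‖fderiv ℝ U x (b i)‖ ^ 2 ≤ ∑ _i : Fin 3, K₁ ^ 2 := Finset.sum_le_sum fun i _ => by
          have h1 : ‖fderiv ℝ U x (b i)‖ ≤ K₁ := by
            calc ‖fderiv ℝ U x (b i)‖ ≤ ‖fderiv ℝ U x‖ * ‖b i‖ := ContinuousLinearMap.le_opNorm _ _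
              _ ≤ K₁ := by rw [b.orthonormal.1 i, mul_one]; exact hK₁ x
          exact pow_le_pow_left₀ (norm_nonneg _) h1 2
      _ = 3 * K₁ ^ 2 := by simp
  have hFB : ∀ x, ‖F x‖ ≤ 3 * K₁ ^ 2 := fun x => by
    rw [Real.norm_of_nonneg (hF0 x)]; exact hFB' x
  obtain ⟨a, c, K, ha, hc, hK0, hineq⟩ := decay_energy_dyadic_estimate hL hprof hU hP hper hPper hM
    hK₁ hFB' hK₃ hdecay' E (fun r => rfl)
  have hFper : IsAxiallyPeriodic L F := fun x => by
    simp only [hF, isAxiallyPeriodic_fderiv hper x]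
  have hEint : ∀ r, 0 < r → IntegrableOn F (zSlab L 0 ∩ {x | cylRadius x < r}) volume :=
    fun r hr => integrableOn_zSlab_inter_cyl_of_bound hL hr hFc hFB
  have hmono : ∀ r s, 1 ≤ r → r ≤ s → E r ≤ E s := fun r s hr hrs =>
    setIntegral_mono_set (hEint s (by linarith)) (Eventually.of_forall fun x => hF0 x)
      (Eventually.of_forall fun x hx => ⟨hx.1, lt_of_lt_of_le hx.2 hrs⟩)
  have hE0 : ∀ r, 1 ≤ r → 0 ≤ E r := fun r _ =>
    setIntegral_nonneg ((measurableSet_zSlab L 0).inter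
      (isOpen_lt continuous_cylRadius continuous_const).measurableSet) fun x _ => hF0 x
  have hEA : ∀ r, 1 ≤ r → E r ≤ 3 * K₁ ^ 2 * (8 * L) * r ^ 2 := by
    intro r hr
    have hr0 : 0 < r := by linarith
    have hvol := volume_zSlab_inter_cyl_le hL hr0
    have hfin : volume (zSlab L 0 ∩ {x | cylRadius x < r}) ≠ ⊤ :=
      (lt_of_le_of_lt hvol ENNReal.ofReal_lt_top).ne
    have hmeas : MeasurableSet (zSlab L 0 ∩ {x : EuclideanSpace ℝ (Fin 3) | cylRadius x < r}) :=
      (measurableSet_zSlab L 0).inter (isOpen_lt continuous_cylRadius continuous_const).measurableSet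
    calc E r ≤ ∫ x in zSlab L 0 ∩ {x | cylRadius x < r}, (3 * K₁ ^ 2 : ℝ) := by
          refine setIntegral_mono_on (hEint r hr0) ?_ hmeas fun x _ => ?_
          · exact integrableOn_const hfin
          · exact hFB' x
      _ = (volume (zSlab L 0 ∩ {x | cylRadius x < r})).toReal * (3 * K₁ ^ 2) := by
          rw [setIntegral_const, smul_eq_mul, measureReal_def]
      _ ≤ (8 * L * r ^ 2) * (3 * K₁ ^ 2) :=
          mul_le_mul_of_nonneg_right (ENNReal.toReal_le_of_le_ofReal (by positivity) hvol)
            (by positivity)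
      _ = 3 * K₁ ^ 2 * (8 * L) * r ^ 2 := by ring
  -- the `o(1)` Saint-Venant lemma
  have hEzero : ∀ r, 1 ≤ r → E r = 0 := by
    refine saintVenant_dyadic_eventually (γ := 0) le_rfl ha hc hmono hE0 hEA fun ε hε => ?_
    obtain ⟨R, hR1, hR⟩ := hineq (min ε 1 / (K + 1)) (by positivity)
      ((div_le_one (by positivity)).2 ((min_le_right _ _).trans (by linarith)))
    refine ⟨R, hR1, fun r hr lam hlam => ?_⟩
    have h1 := hR r hr lam hlam
    have h2 : K * (min ε 1 / (K + 1)) ≤ ε := by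
      rw [mul_div_assoc']
      rw [div_le_iff₀ (by positivity)]
      nlinarith [min_le_left ε 1, min_le_right ε 1, hK0, hε]
    have hr0 : 0 < r := by linarith
    rw [zero_mul, zero_div]
    linarith
  -- `DU ≡ 0`, `U` constant, and the constant is axial by the decay
  have hFzero : ∀ x, F x = 0 :=
    eq_zero_of_setIntegral_zSlab_eq_zero hL hFc hF0 hFper hFB hEzero
  have hDU : ∀ x, fderiv ℝ U x = 0 := fun x => HelicalSlab.eq_zero_of_frobeniusNormSq_eq_zero (hFzero x)
  have hconst : ∀ x, U x = U 0 := fun x => is_const_of_fderiv_eq_zero hUd hDU x 0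
  set C₀ : EuclideanSpace ℝ (Fin 3) := U 0 with hC₀
  have hcoord : ∀ (i : Fin 3) (e : EuclideanSpace ℝ (Fin 3)), (∀ s : ℝ, 0 < s → cylRadius (s • e) = s) →
      (∀ s : ℝ, ⟪horizPart (s • e), C₀⟫ = s * C₀ i) → C₀ i = 0 := by
    intro i e hcyl hinner
    by_contra hne
    have hpos : 0 < |C₀ i| := abs_pos.2 hne
    obtain ⟨R, hR⟩ := hdecay' (|C₀ i| / 2) (by positivity)
    set t : ℝ := max R 1 with ht
    have ht1 : 1 ≤ t := le_max_right _ _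
    have ht0 : 0 < t := lt_of_lt_of_le one_pos ht1
    have h1 := hR (t • e) (by rw [hcyl t ht0]; exact le_max_left _ _)
    rw [hconst, hinner t, abs_mul, abs_of_pos ht0] at h1
    nlinarith
  have hc0 : C₀ 0 = 0 := by
    refine hcoord 0 (EuclideanSpace.single 0 1) (fun s hs => ?_) (fun s => ?_)
    · rw [cylRadius_smul_single_zero, abs_of_pos hs]
    · rw [inner_horizPart_left]; simp
  have hc1 : C₀ 1 = 0 := by
    refine hcoord 1 (EuclideanSpace.single 1 1) (fun s hs => ?_) (fun s => ?_)
    · have : cylRadius (s • EuclideanSpace.single 1 (1 : ℝ) : EuclideanSpace ℝ (Fin 3)) = |s| := by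
        rw [cylRadius, ← Real.sqrt_sq_eq_abs]
        congr 1
        simp
      rw [this, abs_of_pos hs]
    · rw [inner_horizPart_left]; simp
  refine ⟨C₀ 2, funext fun x => ?_⟩
  rw [hconst x]
  ext i
  fin_cases i
  · simp [eZ, hc0]
  · simp [eZ, hc1]
  · simp [eZ]

/-- **The Liouville theorem for bounded periodic steady flows with decaying radial velocity
(Bang–Gui–Wang–Xie 2025, Thm 1.4 (c)), any viscosity `ν > 0`.** For `ν > 0` and `L > 0`, a
smooth steady solution `(U, P)` of the unforced Navier–Stokes system on `ℝ³`
(`IsLerayProfile ν 0 U P`, `U, P ∈ C^∞`) with `U` bounded, axially `L`-periodic, and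
`r u^r → 0` uniformly as `r → ∞` (`∀ ε > 0 ∃ R, |ρ(x) u_r(x)| ≤ ε` for `ρ(x) ≥ R`) is an axial
constant `U ≡ c e₃`. -/
theorem periodicSlab_liouville_radialDecay {ν L : ℝ} (hν : 0 < ν) (hL : 0 < L)
    {U : EuclideanSpace ℝ (Fin 3) → EuclideanSpace ℝ (Fin 3)} {P : EuclideanSpace ℝ (Fin 3) → ℝ}
    (hprof : IsLerayProfile ν 0 U P) (hU : ContDiff ℝ (⊤ : ℕ∞) U) (hP : ContDiff ℝ (⊤ : ℕ∞) P)
    (hbd : ∃ M : ℝ, ∀ x, ‖U x‖ ≤ M) (hper : IsAxiallyPeriodic L U)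
    (hdecay : ∀ ε : ℝ, 0 < ε → ∃ R : ℝ, ∀ x, R ≤ cylRadius x →
      |cylRadius x * radialVelocity U x| ≤ ε) :
    ∃ c : ℝ, U = fun _ => c • eZ := by
  obtain ⟨M, hM⟩ := hbd
  set V : EuclideanSpace ℝ (Fin 3) → EuclideanSpace ℝ (Fin 3) := fun x => ν⁻¹ • U x with hV
  set Q : EuclideanSpace ℝ (Fin 3) → ℝ := fun x => ν⁻¹ ^ 2 • P x with hQ
  have hprof1 : IsLerayProfile 1 0 V Q := hprof.inv_smul_viscosity hν.ne'
  have hVs : ContDiff ℝ (⊤ : ℕ∞) V := hU.const_smul ν⁻¹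
  have hQs : ContDiff ℝ (⊤ : ℕ∞) Q := hP.const_smul (ν⁻¹ ^ 2)
  have hVbd : ∃ M' : ℝ, ∀ x, ‖V x‖ ≤ M' := ⟨|ν⁻¹| * M, fun x => by
    show ‖ν⁻¹ • U x‖ ≤ |ν⁻¹| * M
    rw [norm_smul, Real.norm_eq_abs]
    exact mul_le_mul_of_nonneg_left (hM x) (abs_nonneg _)⟩
  have hVper : IsAxiallyPeriodic L V := fun x => by
    show ν⁻¹ • U (x + L • EuclideanSpace.single 2 (1 : ℝ)) = ν⁻¹ • U x
    rw [hper x]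
  have hVdec : ∀ ε : ℝ, 0 < ε → ∃ R : ℝ, ∀ x, R ≤ cylRadius x →
      |cylRadius x * radialVelocity V x| ≤ ε := by
    intro ε hε
    obtain ⟨R, hR⟩ := hdecay (ν * ε) (by positivity)
    refine ⟨R, fun x hx => ?_⟩
    have h1 := hR x hx
    have e : cylRadius x * radialVelocity V x = ν⁻¹ * (cylRadius x * radialVelocity U x) := by
      simp only [radialVelocity, hV, real_inner_smul_left]; ring
    rw [e, abs_mul, abs_of_pos (inv_pos.2 hν)]
    rw [inv_mul_le_iff₀ hν]
    exact h1
  obtain ⟨c, hc⟩ := periodicSlab_liouville_radialDecay_one hL hprof1 hVs hQs hVbd hVper hVdec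
  refine ⟨ν * c, funext fun x => ?_⟩
  have hx : ν⁻¹ • U x = c • eZ := congrFun hc x
  have := congrArg (fun v => ν • v) hx
  simpa [smul_smul, mul_inv_cancel₀ hν.ne'] using this

end Summit.NavierStokesRegularity.NavierStokesRegularity.Theorems.ScenarioCensus.PeriodicSlab

end
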